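import Summits.QuantumFields.BalabanUV.T4Continuum.Spine.NE3.LandauProjectionSupFlat
import HarnessLib

/-!
# NE7ProfileFieldFlat — BLOCKWISE PROFILE FIELDS `y ↦ g(res_M(y+s)) • C(blk_M(y+s))` AT THE FLAT BACKGROUND: periodicity, skewness, corner values,
# the EXACT blockwise flat Laplacian `Δ_1(Φ_g C) = Φ_{Lg} C` for boundary-free profiles, and the block-diagonal pairing
# `Σ_y hsR (Φ_g C y)(F y) = Σ_w hsR (C w)(Σ_r g r • F(M•w + r − s))`; file 26 (generic lattice calculus for the SMOOTH-BUMP test class)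

Cell `pub-balaban`, rung (B)+1 sub-cell t4, lineage `b2b-balaban-t4-ne7-p1` (CRUX PROVER NE7 #1 = OWNER of row NE7), generation 78; memo
`t4/b2b-balaban-t4-ne7-p1-g78/BUMP-CLASS-FLAT.md` §1–§2.  File F95 (over the tree's block calculus `SmoothRefineBlocks.{blk, res}`, `NE3BlockLineAverage.sum_periodBox_blocks`,
`T4AveragingDeficitWallBoundary.sum_periodBox_shift`, and row NE3's flat dictionary `LandauCorrectionSupB8FlatH0.covLapSite_flatCfg_eq_neg_laplacian`).
WHY (memo g77 `GAUGED-TOP-TT.md` §12, memo g78 §1).  After gen 77 the pinned (1.38)-Landau representative («REP WITH A FIXED TOP») is docked modulo ONE object, the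
Landau-harmonic corner interpolation (LHCI) of the chosen TEST class `T` (F90∕F93).  For the block-mean classes (cornered, dual) the LHCI is a coarse circulant — not
elementary.  The SMOOTH-BUMP class makes it EXPLICIT: its generators are profile fields `Φ_g C : y ↦ g(res_M(y+s)) • C(blk_M(y+s))` — a scalar profile `g` on the block
`[0,M)^d` times a coarse (corner-indexed) skew datum `C`, read in the blocks CENTRED at the corners (`s = ⌊M∕2⌋·𝟙`).  THIS FILE is the generic calculus of such
fields (any profile `g`, any shift `s`): when `g` is BOUNDARY-FREE (vanishes unless `1 ≤ r_i ≤ M − 2`) the flat covariant Laplacian acts blockwise and exactly,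
`Δ_1(Φ_g C) = Φ_{Lg} C` with `(Lg)(r) = Σ_ν (2g(r) − g(r−e_ν) − g(r+e_ν))`, and `hsR`-pairings against any field decompose block by block.  Consumers: F96 (flat LHCI of the
bump class, explicit), F97 (its uniqueness), the flat Galerkin letters.
WHAT ([folklore] lattice calculus; 0 def, 0 sorry).  §1 unshifted fields (`s = 0`): `prof_add_period`, `prof_mem_skew`, `prof_block_point`, `prof_add_e`, `prof_sub_e`,
**`covLapSite_flatCfg_prof`**, **`sum_hsR_prof`**, `sum_hsR_prof_prof`.  §2 shifted fields: `profS_add_period`, `profS_mem_skew`, **`profS_corner`**,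
**`covLapSite_flatCfg_profS`**, **`sum_hsR_profS`**, `sum_hsR_profS_profS`, `norm_profS_le`.
HONEST FRAMING (page 1): pure lattice calculus at the TRIVIAL background; nothing about curved backgrounds; nothing of Bałaban's asserted; (APE) NOT proved; NOT ONE-STEP,
NOT NE7; spine 0∕9; finite T⁴ rung (B)+1 — NOT infinite volume, NOT mass gap, NOT `BetaPertH`, NOT Clay.  Continuum YM on T⁴ ⇐ BetaPertH ∧ nine spine estimates
(0/9 proved); BetaPertH ⇐ (D1) ∧ (D4) ∧ CAP+tail; G-an2-4 gates asym, D1 and NE2/3/4.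
-/

set_option autoImplicit false

open scoped BigOperators Matrix Matrix.Norms.L2Operator
open NormedSpace Finset

namespace Summit.QuantumFields.BalabanUV.T4Continuum.NE7ProfileFieldFlat

open Literature.MathematicalPhysics.QuantumFieldTheory.Balaban1983to89
open B7Prop1Explicit B7Prop2Explicit MatrixNorms
open T4AveragingDeficitWallBoundary (periodBox mem_periodBox sum_periodBox_shift)
open MinimalActionWitness (flatCfg)
open SmoothRefineBlocks (blk res blk_res_add_period blk_res_eq_of res_nonneg res_le res_lt blk_add_e res_add_e_self res_add_e_ne)
open NE3SquaredTentProfile (res_blk_sub_e_of_res_eq_zero res_blk_sub_e_of_res_ne_zero res_sub_e_ne)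
open NE3CovariantCalculus (hsR hsR_sum_right hsR_add_right hsR_sub_right)
open NE3FrameFreeDecompositionPrep (hsR_smul_left hsR_smul_right)
open NE3BlockLineAverage (sum_periodBox_blocks)
open NE3.PairLandauB8 (covLapSite)
open NE3.LandauCorrectionSupB8FlatH0 (covLapSite_flatCfg_eq_neg_laplacian)

noncomputable section

variable {d : ℕ} {n : Type*} [Fintype n] [DecidableEq n]

/-! ## §1 Unshifted profile fields `y ↦ g(res_M y) • C(blk_M y)` -/

omit [Fintype n] [DecidableEq n] in
/-- Periodicity: an `N`-periodic coarse datum gives an `(N·M)`-periodic profile field. [folklore] -/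
theorem prof_add_period {M : ℕ} (hM : 1 ≤ M) {N : ℕ} (g : Site d → ℝ) {C : Site d → Matrix n n ℂ}
    (hC : ∀ (w : Site d) (i : Fin d), C (w + (N : ℤ) • e i) = C w) (y : Site d) (i : Fin d) :
    (fun x => g (res M x) • C (blk M x)) (y + ((N * M : ℕ) : ℤ) • e i) = (fun x => g (res M x) • C (blk M x)) y := by
  obtain ⟨hb, hr⟩ := blk_res_add_period (d := d) hM y (N : ℤ) i
  have hP : ((N * M : ℕ) : ℤ) = (M : ℤ) * (N : ℤ) := by push_cast; ring
  simp only [hP, hb, hr, hC]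

omit [Fintype n] [DecidableEq n] in
/-- Skewness: a skew coarse datum gives a skew profile field. [folklore] -/
theorem prof_mem_skew (M : ℕ) (g : Site d → ℝ) {C : Site d → Matrix n n ℂ} (hC : ∀ w, C w ∈ skewAdjoint (Matrix n n ℂ)) (y : Site d) :
    (fun x => g (res M x) • C (blk M x)) y ∈ skewAdjoint (Matrix n n ℂ) :=
  skewAdjoint.smul_mem _ (hC _)

omit [Fintype n] [DecidableEq n] in
/-- Value at a block point `M•w + r`, `r ∈ [0,M)^d`: `g r • C w`. [folklore] -/
theorem prof_block_point {M : ℕ} (hM : 1 ≤ M) (g : Site d → ℝ) (C : Site d → Matrix n n ℂ) (w : Site d) {r : Site d}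
    (hr0 : ∀ i, 0 ≤ r i) (hr1 : ∀ i, r i < M) :
    (fun x => g (res M x) • C (blk M x)) ((M : ℤ) • w + r) = g r • C w := by
  obtain ⟨hb, hr⟩ := blk_res_eq_of (L := M) (y := (M : ℤ) • w + r) hM rfl hr0 hr1
  simp only [hb, hr]

omit [Fintype n] [DecidableEq n] in
/-- A forward unit step, for a BOUNDARY-FREE profile (`g r ≠ 0 ⇒ 1 ≤ r_i ≤ M − 2`): the block does not change where it matters,
`Φ(y + e_μ) = g(res y + e_μ) • C(blk y)`. [folklore] -/
theorem prof_add_e {M : ℕ} (hM : 1 ≤ M) {g : Site d → ℝ} (hg : ∀ r : Site d, g r ≠ 0 → ∀ i, 1 ≤ r i ∧ r i ≤ (M : ℤ) - 2)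
    (C : Site d → Matrix n n ℂ) (y : Site d) (μ : Fin d) :
    (fun x => g (res M x) • C (blk M x)) (y + e μ) = g (res M y + e μ) • C (blk M y) := by
  by_cases h : res M y μ = (M : ℤ) - 1
  · -- crossing the last slice: both sides vanish
    have h1 : g (res M (y + e μ)) = 0 := by
      by_contra hne
      have := (hg _ hne μ).1
      rw [res_add_e_self hM, if_pos h] at this
      omega
    have h2 : g (res M y + e μ) = 0 := by
      by_contra hne
      have := (hg _ hne μ).2
      simp only [Pi.add_apply, e_apply, if_true] at this
      omega
    simp only [h1, h2, zero_smul]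
  · have hb : blk M (y + e μ) = blk M y := by rw [blk_add_e hM, if_neg h, add_zero]
    have hr : res M (y + e μ) = res M y + e μ := by
      rw [(SmoothRefineBlocks.blk_res_add_e hM y μ).2, if_neg h]
    simp only [hb, hr]

omit [Fintype n] [DecidableEq n] in
/-- A backward unit step, for a boundary-free profile: `Φ(y − e_μ) = g(res y − e_μ) • C(blk y)`. [folklore] -/
theorem prof_sub_e {M : ℕ} (hM : 1 ≤ M) {g : Site d → ℝ} (hg : ∀ r : Site d, g r ≠ 0 → ∀ i, 1 ≤ r i ∧ r i ≤ (M : ℤ) - 2)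
    (C : Site d → Matrix n n ℂ) (y : Site d) (μ : Fin d) :
    (fun x => g (res M x) • C (blk M x)) (y - e μ) = g (res M y - e μ) • C (blk M y) := by
  by_cases h : res M y μ = 0
  · -- crossing the entering slice backwards: both sides vanish
    obtain ⟨hr', -⟩ := res_blk_sub_e_of_res_eq_zero hM h
    have h1 : g (res M (y - e μ)) = 0 := by
      by_contra hne
      have := (hg _ hne μ).2
      rw [hr'] at this
      omega
    have h2 : g (res M y - e μ) = 0 := by
      by_contra hne
      have := (hg _ hne μ).1
      simp only [Pi.sub_apply, e_apply, if_true, h] at this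
      omega
    simp only [h1, h2, zero_smul]
  · obtain ⟨hr', hb'⟩ := res_blk_sub_e_of_res_ne_zero hM h
    have hr : res M (y - e μ) = res M y - e μ := by
      ext ν
      by_cases hν : ν = μ
      · subst hν; simp only [hr', Pi.sub_apply, e_apply, if_true]
      · rw [res_sub_e_ne hM y hν]; simp only [Pi.sub_apply, e_apply, if_neg hν, sub_zero]
    simp only [hb', hr]

/-- **THE FLAT LAPLACIAN OF A BOUNDARY-FREE PROFILE FIELD IS THE PROFILE FIELD OF THE PROFILE'S LAPLACIAN**:
`Δ_1(Φ_g C)(y) = (Σ_ν (2g(r) − g(r − e_ν) − g(r + e_ν))) • C(blk y)`, `r = res_M y` (blockwise, exact, no leakage across block faces). [folklore] -/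
theorem covLapSite_flatCfg_prof {M : ℕ} (hM : 1 ≤ M) {g : Site d → ℝ} (hg : ∀ r : Site d, g r ≠ 0 → ∀ i, 1 ≤ r i ∧ r i ≤ (M : ℤ) - 2)
    (C : Site d → Matrix n n ℂ) (y : Site d) :
    covLapSite (flatCfg (d := d) (n := n)) (fun x => g (res M x) • C (blk M x)) y
      = (fun x => (∑ ν : Fin d, (2 * g (res M x) - g (res M x - e ν) - g (res M x + e ν))) • C (blk M x)) y := by
  rw [covLapSite_flatCfg_eq_neg_laplacian, ← Finset.sum_neg_distrib]
  simp only [Finset.sum_smul]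
  refine Finset.sum_congr rfl fun μ _ => ?_
  have h1 := prof_add_e hM hg C y μ
  have h2 := prof_sub_e hM hg C y μ
  simp only at h1 h2
  rw [h1, h2]
  simp only [sub_smul, mul_smul, two_smul]
  abel

/-- **THE BLOCK-DIAGONAL PAIRING** of a profile field with ANY field over the period `N·M`:
`Σ_{y∈[0,NM)^d} hsR (Φ_g C y)(F y) = Σ_{w∈[0,N)^d} hsR (C w) (Σ_{r∈[0,M)^d} g r • F(M•w + r))`. [folklore] -/
theorem sum_hsR_prof {M : ℕ} (hM : 1 ≤ M) (N : ℕ) (g : Site d → ℝ) (C : Site d → Matrix n n ℂ) (F : Site d → Matrix n n ℂ) :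
    ∑ y ∈ periodBox (d := d) (N * M), hsR ((fun x => g (res M x) • C (blk M x)) y) (F y)
      = ∑ w ∈ periodBox (d := d) N, hsR (C w) (∑ r ∈ periodBox (d := d) M, g r • F ((M : ℤ) • w + r)) := by
  rw [Nat.mul_comm, ← sum_periodBox_blocks M N hM]
  refine Finset.sum_congr rfl fun w _ => ?_
  rw [hsR_sum_right]
  refine Finset.sum_congr rfl fun r hr => ?_
  have hr' := mem_periodBox.mp hr
  rw [prof_block_point hM g C w (fun i => (hr' i).1) (fun i => (hr' i).2), hsR_smul_left, hsR_smul_right]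

/-- The pairing of two profile fields with the same block structure: `(Σ_r g r · h r) · Σ_w hsR (C w)(C' w)`. [folklore] -/
theorem sum_hsR_prof_prof {M : ℕ} (hM : 1 ≤ M) (N : ℕ) (g h : Site d → ℝ) (C C' : Site d → Matrix n n ℂ) :
    ∑ y ∈ periodBox (d := d) (N * M), hsR ((fun x => g (res M x) • C (blk M x)) y) ((fun x => h (res M x) • C' (blk M x)) y)
      = (∑ r ∈ periodBox (d := d) M, g r * h r) * ∑ w ∈ periodBox (d := d) N, hsR (C w) (C' w) := by
  rw [sum_hsR_prof hM N g C]
  rw [Finset.mul_sum]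
  refine Finset.sum_congr rfl fun w _ => ?_
  have hin : ∀ r ∈ periodBox (d := d) M, g r • (fun x => h (res M x) • C' (blk M x)) ((M : ℤ) • w + r) = (g r * h r) • C' w := by
    intro r hr
    have hr' := mem_periodBox.mp hr
    rw [prof_block_point hM h C' w (fun i => (hr' i).1) (fun i => (hr' i).2), smul_smul]
  rw [Finset.sum_congr rfl hin, ← Finset.sum_smul, hsR_smul_right]

/-! ## §2 Shifted profile fields `y ↦ g(res_M(y+s)) • C(blk_M(y+s))` (blocks translated by `−s`; `s = ⌊M∕2⌋·𝟙` centres them at the corners) -/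

omit [Fintype n] [DecidableEq n] in
/-- Periodicity of the shifted field. [folklore] -/
theorem profS_add_period {M : ℕ} (hM : 1 ≤ M) {N : ℕ} (s : Site d) (g : Site d → ℝ) {C : Site d → Matrix n n ℂ}
    (hC : ∀ (w : Site d) (i : Fin d), C (w + (N : ℤ) • e i) = C w) (y : Site d) (i : Fin d) :
    (fun x => g (res M (x + s)) • C (blk M (x + s))) (y + ((N * M : ℕ) : ℤ) • e i) = (fun x => g (res M (x + s)) • C (blk M (x + s))) y := by
  have h := prof_add_period hM g hC (y + s) i
  simp only at h ⊢
  rw [add_right_comm, h]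

omit [Fintype n] [DecidableEq n] in
/-- Skewness of the shifted field. [folklore] -/
theorem profS_mem_skew (M : ℕ) (s : Site d) (g : Site d → ℝ) {C : Site d → Matrix n n ℂ} (hC : ∀ w, C w ∈ skewAdjoint (Matrix n n ℂ))
    (y : Site d) : (fun x => g (res M (x + s)) • C (blk M (x + s))) y ∈ skewAdjoint (Matrix n n ℂ) :=
  skewAdjoint.smul_mem _ (hC _)

omit [Fintype n] [DecidableEq n] in
/-- **CORNER VALUES** of the shifted field (`s ∈ [0,M)^d`): `Φ(M•w) = g s • C w`. [folklore] -/
theorem profS_corner {M : ℕ} (hM : 1 ≤ M) {s : Site d} (hs0 : ∀ i, 0 ≤ s i) (hs1 : ∀ i, s i < M) (g : Site d → ℝ)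
    (C : Site d → Matrix n n ℂ) (w : Site d) :
    (fun x => g (res M (x + s)) • C (blk M (x + s))) ((M : ℤ) • w) = g s • C w := by
  have h := prof_block_point hM g C w hs0 hs1
  simpa using h

/-- Sup bound of the shifted field: `‖Φ y‖ ≤ (sup|g|)·(sup‖C‖)`. [folklore] -/
theorem norm_profS_le (M : ℕ) (s : Site d) {g : Site d → ℝ} {C : Site d → Matrix n n ℂ} {G A : ℝ} (hG : ∀ r, |g r| ≤ G)
    (hA : ∀ w, ‖C w‖ ≤ A) (y : Site d) : ‖(fun x => g (res M (x + s)) • C (blk M (x + s))) y‖ ≤ G * A := by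
  simp only [norm_smul, Real.norm_eq_abs]
  exact mul_le_mul (hG _) (hA _) (norm_nonneg _) ((abs_nonneg (g (res M (y + s)))).trans (hG _))

/-- The flat Laplacian commutes with translations. [folklore] -/
theorem covLapSite_flatCfg_translate (f : Site d → Matrix n n ℂ) (s y : Site d) :
    covLapSite (flatCfg (d := d) (n := n)) (fun x => f (x + s)) y = covLapSite (flatCfg (d := d) (n := n)) f (y + s) := by
  rw [covLapSite_flatCfg_eq_neg_laplacian, covLapSite_flatCfg_eq_neg_laplacian]
  congr 1
  refine Finset.sum_congr rfl fun μ _ => ?_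
  rw [add_right_comm y (e μ) s, sub_add_eq_add_sub y (e μ) s]

/-- **THE FLAT LAPLACIAN OF A SHIFTED BOUNDARY-FREE PROFILE FIELD**: `Δ_1 Φ_g = Φ_{Lg}` (same shift, same datum). [folklore] -/
theorem covLapSite_flatCfg_profS {M : ℕ} (hM : 1 ≤ M) (s : Site d) {g : Site d → ℝ} (hg : ∀ r : Site d, g r ≠ 0 → ∀ i, 1 ≤ r i ∧ r i ≤ (M : ℤ) - 2)
    (C : Site d → Matrix n n ℂ) (y : Site d) :
    covLapSite (flatCfg (d := d) (n := n)) (fun x => g (res M (x + s)) • C (blk M (x + s))) y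
      = (fun x => (∑ ν : Fin d, (2 * g (res M (x + s)) - g (res M (x + s) - e ν) - g (res M (x + s) + e ν))) • C (blk M (x + s))) y := by
  have h := covLapSite_flatCfg_translate (d := d) (n := n) (fun x => g (res M x) • C (blk M x)) s y
  simp only at h ⊢
  rw [h, covLapSite_flatCfg_prof hM hg C (y + s)]

/-- **THE BLOCK-DIAGONAL PAIRING OF A SHIFTED PROFILE FIELD** with an `(N·M)`-periodic field:
`Σ_{y∈[0,NM)^d} hsR (Φ y)(F y) = Σ_{w∈[0,N)^d} hsR (C w)(Σ_{r∈[0,M)^d} g r • F(M•w + r − s))`. [folklore] -/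
theorem sum_hsR_profS {M : ℕ} (hM : 1 ≤ M) {N : ℕ} (hN : 1 ≤ N) (s : Site d) (g : Site d → ℝ) (C : Site d → Matrix n n ℂ)
    {F : Site d → Matrix n n ℂ} (hF : ∀ (y : Site d) (i : Fin d), F (y + ((N * M : ℕ) : ℤ) • e i) = F y)
    (hC : ∀ (w : Site d) (i : Fin d), C (w + (N : ℤ) • e i) = C w) :
    ∑ y ∈ periodBox (d := d) (N * M), hsR ((fun x => g (res M (x + s)) • C (blk M (x + s))) y) (F y)
      = ∑ w ∈ periodBox (d := d) N, hsR (C w) (∑ r ∈ periodBox (d := d) M, g r • F ((M : ℤ) • w + r - s)) := by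
  have hP : 1 ≤ N * M := Nat.mul_pos (by omega) (by omega)
  -- shift the summation variable by `s`
  have hper : ∀ (x : Site d) (κ : Fin d), (fun x => hsR (g (res M x) • C (blk M x)) (F (x - s))) (x + ((N * M : ℕ) : ℤ) • e κ)
      = (fun x => hsR (g (res M x) • C (blk M x)) (F (x - s))) x := by
    intro x κ
    have h1 := prof_add_period hM g hC x κ
    simp only at h1 ⊢
    rw [h1, add_sub_right_comm, hF]
  have hshift := sum_periodBox_shift (N * M) hP (g := fun x => hsR (g (res M x) • C (blk M x)) (F (x - s))) hper s
  simp only [add_sub_cancel_right] at hshift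
  simp only
  rw [hshift, sum_hsR_prof hM N g C]

/-- The pairing of two shifted profile fields (same shift, same block structure): `(Σ_r g r · h r) · Σ_w hsR (C w)(C' w)`. [folklore] -/
theorem sum_hsR_profS_profS {M : ℕ} (hM : 1 ≤ M) {N : ℕ} (hN : 1 ≤ N) (s : Site d) (g h : Site d → ℝ) {C C' : Site d → Matrix n n ℂ}
    (hC : ∀ (w : Site d) (i : Fin d), C (w + (N : ℤ) • e i) = C w) (hC' : ∀ (w : Site d) (i : Fin d), C' (w + (N : ℤ) • e i) = C' w) :
    ∑ y ∈ periodBox (d := d) (N * M), hsR ((fun x => g (res M (x + s)) • C (blk M (x + s))) y) ((fun x => h (res M (x + s)) • C' (blk M (x + s))) y)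
      = (∑ r ∈ periodBox (d := d) M, g r * h r) * ∑ w ∈ periodBox (d := d) N, hsR (C w) (C' w) := by
  have hP : 1 ≤ N * M := Nat.mul_pos (by omega) (by omega)
  have hper : ∀ (x : Site d) (κ : Fin d),
      (fun x => hsR (g (res M x) • C (blk M x)) (h (res M x) • C' (blk M x))) (x + ((N * M : ℕ) : ℤ) • e κ)
      = (fun x => hsR (g (res M x) • C (blk M x)) (h (res M x) • C' (blk M x))) x := by
    intro x κ
    have h1 := prof_add_period hM g hC x κ
    have h2 := prof_add_period hM h hC' x κ
    simp only at h1 h2 ⊢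
    rw [h1, h2]
  have hshift := sum_periodBox_shift (N * M) hP (g := fun x => hsR (g (res M x) • C (blk M x)) (h (res M x) • C' (blk M x))) hper s
  simp only
  rw [hshift]
  exact sum_hsR_prof_prof hM N g h C C'

end

end Summit.QuantumFields.BalabanUV.T4Continuum.NE7ProfileFieldFlat
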